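import Literature.AlgebraicGeometry.HodgeTheory.SimplePrimeDimensionHodgeClassesResidual
import Literature.AlgebraicGeometry.Motives.HodgeThetaSubalgebraUnitaryFiveCore
import HarnessLib

/-!
# Hodge classes on all powers of abelian varieties of Ribet type `(5, n″)`, `n″ ≡ ±2 (mod 5)`, are generated by divisor
# classes (Ribet 1983 Thm. 3 at these multiplicities — UNCONDITIONAL; the prime dimensions `17 = 5 + 12`, `19 = 5 + 14`)

Family `hodge`, layer `Literature/AlgebraicGeometry/HodgeTheory`. Research context: cell `pub-hodge-ring2` (HONEST
FRAMING: research route conditional on HC_CM; not a corollary; Q11.4-sentence-2 already refuted in dim ≥ 3),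
Literature lane gen 83, programme R65. UNCONDITIONAL for the class of abelian varieties it names; theorems only, no
definition, no named fact (D-0026), no `sorry`. The CELL of the generic assembly `RibetTypeOfCorePowersHodgeClasses` at
the family core `UnitaryFive.eq_top` / `eq_top'` (`Motives/HodgeThetaSubalgebraUnitaryFiveCore`), and the census of
prime dimensions `17` and `19`: there the Tankeev–Ribet statement now needs only `End⁰ = ℚ` and the imaginary-quadratic
signatures `{6,11}`, `{7,10}`, `{8,9}` (dim `17`) resp. `{6,13}`, `{7,12}`, `{8,11}`, `{9,10}` (dim `19`).

THE PRINTED THEOREM. Ribet, Amer. J. Math. 105 (1983), Thm. 3 = Gordon's survey Thm. 6.3 (3) [held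
`paper:arxiv-alg-geom_9709030` p. 18].

## References
* [Ribet1983] K. A. Ribet, Amer. J. Math. 105 (1983), Thm. 0, Thm. 3.
* [Gordon1997] B. B. Gordon, *A survey of the Hodge conjecture for abelian varieties*, Thm. 6.3 (3) and Corollary.
* [MoonenZarhin1999LowDim] B. Moonen, Yu. Zarhin, Math. Ann. 315 (1999), §2 (2.4), Thm. (2.7).
* [Deligne2000] P. Deligne, *The Hodge conjecture* (Clay, 2000), §1.
-/

noncomputable section

open CategoryTheory Module

namespace Literature.AlgebraicGeometry.HodgeTheory

open Literature.AlgebraicGeometry.Motives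
open Literature.AlgebraicGeometry.Motives.HodgeStructure

section Cells

/-- **Ribet 1983 Thm. 3 at `(5, n″)`, `n″ ≡ 2, 4 (mod 5)` — UNCONDITIONAL: `B•(A^{N+1}) = D•(A^{N+1}) ⊗ ℂ`** for a complex
abelian variety `A` with `φ ≫ φ = -d` (`d > 0`), `finrank_ℚ End⁰(A) = 2`, `n_{i√d}(φ) = 5` and `n_{−i√d}(φ) ≡ 2, 4 (mod 5)`
(core `UnitaryFive.eq_top`). [cite: Ribet1983, Thm. 0 and Thm. 3] [cite: Gordon1997, Thm. 6.3 (3) and Corollary] -/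
theorem AbelianVariety.isDivisorGenerated_powSucc_of_ribetTypeFive (A : AbelianVariety ℂ) (φ : A ⟶ A)
    {d : ℕ} (hd : 0 < d) (hφ : φ ≫ φ = -(d • 𝟙 A)) (hE2 : Module.finrank ℚ A.endAlgebra = 2)
    (h5 : eigenMultiplicity A φ (Complex.I * (Real.sqrt d : ℂ)) = 5)
    (hmod : eigenMultiplicity A φ (-(Complex.I * (Real.sqrt d : ℂ))) % 5 = 2 ∨
      eigenMultiplicity A φ (-(Complex.I * (Real.sqrt d : ℂ))) % 5 = 4) (N : ℕ) :
    IsDivisorGenerated (A.powSucc N) := by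
  refine AbelianVariety.isDivisorGenerated_powSucc_of_ribetType_ofCore A φ hd hφ hE2 (by omega) (by omega) ?_ N
  intro W' _ _ _ 𝔊 ι P' Q' s hbr hirr hι hιι hP' hQ' hfinP' hfinQ' hadd hsymm hPQ hdefP hdefQ hadj
  exact UnitaryFive.eq_top hbr hirr hι hιι hP' hQ' (by rw [hfinP', h5]) (by rw [hfinQ']; exact hmod)
    hadd hsymm hPQ hdefP hdefQ hadj

/-- The mirror: `n_{−i√d}(φ) = 5`, `n_{i√d}(φ) ≡ 2, 4 (mod 5)` (core `UnitaryFive.eq_top'`).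
[cite: Ribet1983, Thm. 0 and Thm. 3] [cite: Gordon1997, Thm. 6.3 (3) and Corollary] -/
theorem AbelianVariety.isDivisorGenerated_powSucc_of_ribetTypeFive' (A : AbelianVariety ℂ) (φ : A ⟶ A)
    {d : ℕ} (hd : 0 < d) (hφ : φ ≫ φ = -(d • 𝟙 A)) (hE2 : Module.finrank ℚ A.endAlgebra = 2)
    (hmod : eigenMultiplicity A φ (Complex.I * (Real.sqrt d : ℂ)) % 5 = 2 ∨
      eigenMultiplicity A φ (Complex.I * (Real.sqrt d : ℂ)) % 5 = 4)
    (h5 : eigenMultiplicity A φ (-(Complex.I * (Real.sqrt d : ℂ))) = 5) (N : ℕ) :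
    IsDivisorGenerated (A.powSucc N) := by
  refine AbelianVariety.isDivisorGenerated_powSucc_of_ribetType_ofCore A φ hd hφ hE2 (by omega) (by omega) ?_ N
  intro W' _ _ _ 𝔊 ι P' Q' s hbr hirr hι hιι hP' hQ' hfinP' hfinQ' hadd hsymm hPQ hdefP hdefQ hadj
  exact UnitaryFive.eq_top' hbr hirr hι hιι hP' hQ' (by rw [hfinP']; exact hmod) (by rw [hfinQ', h5])
    hadd hsymm hPQ hdefP hdefQ hadj

/-- **The Hodge conjecture for all powers of an abelian variety of unitary type `(5, n″)`, `n″ ≡ ±2 (mod 5)` —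
UNCONDITIONAL** (e.g. SEVENTEENFOLDS `(5,12)`, NINETEENFOLDS `(5,14)`). [cite: Ribet1983, Thm. 3] [cite: Deligne2000, §1] -/
theorem hodgeConjectureFor_powSucc_of_ribetTypeFive (A : AbelianVariety ℂ) (φ : A ⟶ A)
    {d : ℕ} (hd : 0 < d) (hφ : φ ≫ φ = -(d • 𝟙 A)) (hE2 : Module.finrank ℚ A.endAlgebra = 2)
    (h5 : eigenMultiplicity A φ (Complex.I * (Real.sqrt d : ℂ)) = 5)
    (hmod : eigenMultiplicity A φ (-(Complex.I * (Real.sqrt d : ℂ))) % 5 = 2 ∨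
      eigenMultiplicity A φ (-(Complex.I * (Real.sqrt d : ℂ))) % 5 = 4) (N : ℕ) :
    HodgeConjectureFor (A.powSucc N).dim (A.powSucc N).X :=
  hodgeConjectureFor_of_isDivisorGenerated _
    (AbelianVariety.isDivisorGenerated_powSucc_of_ribetTypeFive A φ hd hφ hE2 h5 hmod N)

end Cells

/-! ### Census: the Tankeev–Ribet residual loses `{5, n″}` with `n″ ≡ ±2 (mod 5)` -/

section Census

/-- **The Tankeev–Ribet fact is EQUIVALENT to: (S1) `End⁰ = ℚ` in prime dimension `≥ 11`, and (S2⁶) imaginary-quadratic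
multiplicities both `≥ 5`, `{n′, n″} ≠ {6,7}`, and NOT of the form `{5, m}` with `m ≡ 2, 4 (mod 5)`** (so in dimension
`17` only `{6,11}`, `{7,10}`, `{8,9}` remain, in dimension `19` only `{6,13}`, `{7,12}`, `{8,11}`, `{9,10}`).
[cite: MoonenZarhin1999LowDim, §2 (2.4)–(2.7)] [cite: Gordon1999HodgeAVSurvey, Thm. 6.3 and Corollary] [cite: Ribet1983, Thms. 1 and 3] -/
theorem tankeevRibet1983_iff_generic_ge_eleven_and_unitary_residual :
    TankeevRibet1983_hodgeClasses_divisorial_powers_simplePrimeDimension ↔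
      (∀ X : AbelianVariety ℂ, X.dim.Prime → 11 ≤ X.dim → X.IsSimple → Module.finrank ℚ X.endAlgebra = 1 →
        ∀ N : ℕ, IsDivisorGenerated (X.powSucc N)) ∧
      (∀ (X : AbelianVariety ℂ) (φ : X ⟶ X) (d : ℕ), X.dim.Prime → X.IsSimple → 0 < d →
        φ ≫ φ = -(d • 𝟙 X) → Module.finrank ℚ X.endAlgebra = 2 →
        5 ≤ eigenMultiplicity X φ (Complex.I * (Real.sqrt d : ℂ)) →
        5 ≤ eigenMultiplicity X φ (-(Complex.I * (Real.sqrt d : ℂ))) →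
        ¬ (eigenMultiplicity X φ (Complex.I * (Real.sqrt d : ℂ)) = 6 ∧
            eigenMultiplicity X φ (-(Complex.I * (Real.sqrt d : ℂ))) = 7) →
        ¬ (eigenMultiplicity X φ (Complex.I * (Real.sqrt d : ℂ)) = 7 ∧
            eigenMultiplicity X φ (-(Complex.I * (Real.sqrt d : ℂ))) = 6) →
        ¬ (eigenMultiplicity X φ (Complex.I * (Real.sqrt d : ℂ)) = 5 ∧
            (eigenMultiplicity X φ (-(Complex.I * (Real.sqrt d : ℂ))) % 5 = 2 ∨
              eigenMultiplicity X φ (-(Complex.I * (Real.sqrt d : ℂ))) % 5 = 4)) →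
        ¬ (eigenMultiplicity X φ (-(Complex.I * (Real.sqrt d : ℂ))) = 5 ∧
            (eigenMultiplicity X φ (Complex.I * (Real.sqrt d : ℂ)) % 5 = 2 ∨
              eigenMultiplicity X φ (Complex.I * (Real.sqrt d : ℂ)) % 5 = 4)) →
        ∀ N : ℕ, IsDivisorGenerated (X.powSucc N)) := by
  rw [tankeevRibet1983_iff_generic_ge_eleven_and_unitary_ge_five]
  refine ⟨fun ⟨hS1, hS5⟩ => ⟨hS1, fun X φ d hp hs hd hφ he2 ha hb h67 h76 _ _ N =>
    hS5 X φ d hp hs hd hφ he2 ha hb h67 h76 N⟩, fun ⟨hS1, hS6⟩ => ⟨hS1, ?_⟩⟩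
  intro X φ d hp hs hd hφ he2 ha hb h67 h76 N
  by_cases h5a : eigenMultiplicity X φ (Complex.I * (Real.sqrt d : ℂ)) = 5 ∧
      (eigenMultiplicity X φ (-(Complex.I * (Real.sqrt d : ℂ))) % 5 = 2 ∨
        eigenMultiplicity X φ (-(Complex.I * (Real.sqrt d : ℂ))) % 5 = 4)
  · exact AbelianVariety.isDivisorGenerated_powSucc_of_ribetTypeFive X φ hd hφ he2 h5a.1 h5a.2 N
  by_cases h5b : eigenMultiplicity X φ (-(Complex.I * (Real.sqrt d : ℂ))) = 5 ∧
      (eigenMultiplicity X φ (Complex.I * (Real.sqrt d : ℂ)) % 5 = 2 ∨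
        eigenMultiplicity X φ (Complex.I * (Real.sqrt d : ℂ)) % 5 = 4)
  · exact AbelianVariety.isDivisorGenerated_powSucc_of_ribetTypeFive' X φ hd hφ he2 h5b.2 h5b.1 N
  exact hS6 X φ d hp hs hd hφ he2 ha hb h67 h76 h5a h5b N

end Census

end Literature.AlgebraicGeometry.HodgeTheory

end
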